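import Summits.FinalStateConjecture.FinalStateConjecture.Theses.BondiDrainDispersal
import Literature.Geometry.Lorentzian.TameGenericityDiagonal
import HarnessLib

/-!
# Crux `HorizonlessMustDrain` (stmt-FinalStateConjecture-9976) — strategy census s6, typed companion

Independent strategist seat `cstrat-stmt-FinalStateConjecture-9976-s6` (family `s`, summit-first inventory).
Question asked FIRST: *what does the Statement, through the route's deciding theorem `closes`, actually need from
this crux, and what strictly weaker intermediate could replace it?*

Answer, kernel-checked below: **nothing that is not already a consequence of the Statement.**  The route's
`closes : HorizonlessMustDrain → DrainImpliesDisperseCKH → GenericCensoredHolesOrRoughSettle → FinalStateConjecture`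
invokes the crux only on CK data inside the horizonless branch of a case split whose other branches are handed to the
residual `GenericCensoredHolesOrRoughSettle` (= the Statement's property weakened by the antecedent "horizon ∨ rough").
Weakening that antecedent once more, to "horizon ∨ rough ∨ the final Bondi mass does NOT vanish", gives a residual
`GenericCensoredHolesOrRoughOrUndrainedSettle` (W below) which

* still follows from `FinalStateConjecture` in two lines (`undrainedSettle_of_finalStateConjecture`) — so it is an honest
  residual by the route's own standard ("FinalStateConjecture ⇒ #5, no overshoot");
* is implied by the pair it replaces (`undrainedSettle_of_holesOrRough_of_horizonlessMustDrain`: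
  `GenericCensoredHolesOrRoughSettle → HorizonlessMustDrain → W`, using the crux on CK data only) and implies the old
  residual back (`holesOrRough_of_undrainedSettle`), i.e. `#5 ∧ HMD ⇒ W ⇒ #5`;
* decides the Statement together with the route's rank-2 crux ALONE:
  `closes_without_horizonlessMustDrain : DrainImpliesDisperseCKH → W → FinalStateConjecture`.

So `HorizonlessMustDrain` — the ∀-data no-soliton theorem at `𝓘⁺` — is ELIMINABLE from the cone of `closes`: its entire
contribution to deciding the Statement is covered by a consequence of the Statement.  What the crux asserts beyond that
(drain for EVERY admissible datum, exceptional data included, with no genericity escape) is not implied by the Statement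
and is not needed for it.  Everything here is pure logic over the route's own decls; no `sorry`, no new definition except
the residual W written out in full (so that nothing reads as a named fact).
-/

noncomputable section

open scoped Manifold ContDiff Topology
open Set Function Literature.Geometry.Lorentzian

namespace Summit.FinalStateConjecture.FinalStateConjecture.Cruxes.HorizonlessMustDrain.CensusS6

open Summit.FinalStateConjecture.FinalStateConjecture.Theses.BondiDrainDispersal
  (HorizonlessMustDrain DrainImpliesDisperseCKH GenericCensoredHolesOrRoughSettle CensoredHorizonlessDisperseCK)

/-- **W — the re-cut residual `GenericCensoredHolesOrRoughOrUndrainedSettle`**: for every data manifold `X`,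
tame-Christodoulou-generically in the admissible class, an MGHD exists and every MGHD has complete `𝓘⁺` and, IF it has an
event horizon (ray-theoretic clause, verbatim) OR the datum has no sole strongly asymptotically flat CK end OR its final
Bondi mass does NOT vanish (`¬ HasVanishingFinalBondiMass`), admits `O` and a `C²` final-state decomposition with every
hole sub-extremal, `O = exteriorOf d.charted`, `RaysStayInClosure`, `HasExhaustiveCharts`, `IsFutureOriented` — the text of
`GenericCensoredHolesOrRoughSettle` with ONE extra disjunct in the antecedent. -/
def GenericCensoredHolesOrRoughOrUndrainedSettle : Prop :=
  ∀ (X : Type) [TopologicalSpace X] [ChartedSpace Literature.Geometry.Lorentzian.E3 X]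
    [IsManifold (𝓡 3) ((⊤ : ℕ∞) : WithTop ℕ∞) X] [T2Space X] [SecondCountableTopology X] [ConnectedSpace X],
    Literature.Geometry.Lorentzian.InitialDataSet.IsTameChristodoulouGeneric
      (Literature.Geometry.Lorentzian.admissibleVacuumData X)
      (fun D ↦ (∃ 𝒟 : Literature.Geometry.Lorentzian.VacuumCauchyDevelopment D, 𝒟.IsMaximal) ∧
        ∀ 𝒟 : Literature.Geometry.Lorentzian.VacuumCauchyDevelopment D, 𝒟.IsMaximal →
          Summit.FinalStateConjecture.HasCompleteNullInfinity 𝒟.toCauchyDevelopment ∧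
          (((∀ [𝒟.metric.HasLeviCivita], ∃ q : 𝒟.carrier, ∀ (p : X) (γ : ℝ → 𝒟.carrier) (dom : Set ℝ),
              𝒟.metric.IsNormalisedNullRayFrom 𝒟.timeOrientation 𝒟.embed 𝒟.normal p γ dom → ¬ BddAbove dom →
                q ∉ 𝒟.metric.chronologicalPast 𝒟.timeOrientation (γ '' (dom ∩ Set.Ici 0))) ∨
            ¬ (∃ (e : Literature.Geometry.Lorentzian.AFEnd X) (M : ℝ),
                e.IsSoleEnd ∧ e.IsStronglyAsymptoticallyFlatCK D M) ∨
            ¬ 𝒟.toCauchyDevelopment.HasVanishingFinalBondiMass) →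
            ∃ (O : Set 𝒟.carrier) (d : Literature.Geometry.Lorentzian.FinalStateDecomposition 𝒟.toSpacetime O 2),
              (∀ i, Literature.Geometry.Lorentzian.Kerr.IsSubextremal (d.mass i) (d.spin i)) ∧
              O = Summit.FinalStateConjecture.exteriorOf 𝒟.toCauchyDevelopment d.charted ∧
              Summit.FinalStateConjecture.RaysStayInClosure 𝒟.toCauchyDevelopment O ∧
              Summit.FinalStateConjecture.HasExhaustiveCharts d ∧
              Summit.FinalStateConjecture.IsFutureOriented d)) 1

/-- **The Statement implies W** (W is a consequence of S, exactly like the route's declared residual): drop the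
antecedent; tame genericity is monotone (`IsTameChristodoulouGeneric.mono`). [folklore] -/
theorem undrainedSettle_of_finalStateConjecture (hS : _root_.FinalStateConjecture) :
    GenericCensoredHolesOrRoughOrUndrainedSettle := by
  intro X _ _ _ _ _ _
  refine (hS X).mono fun D _ h ↦ ⟨h.1, fun 𝒟 h𝒟 ↦ ⟨(h.2 𝒟 h𝒟).1, fun _ ↦ ?_⟩⟩
  obtain ⟨O, d, hsub, hO, hR, hE, hF⟩ := (h.2 𝒟 h𝒟).2
  exact ⟨O, d, hsub, hO, hR, hE, hF⟩

/-- **W implies the route's residual `GenericCensoredHolesOrRoughSettle`** (its antecedent is a sub-disjunction). [folklore] -/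
theorem holesOrRough_of_undrainedSettle (hW : GenericCensoredHolesOrRoughOrUndrainedSettle) :
    GenericCensoredHolesOrRoughSettle := by
  intro X _ _ _ _ _ _
  refine (hW X).mono fun D _ h ↦ ⟨h.1, fun 𝒟 h𝒟 ↦ ⟨(h.2 𝒟 h𝒟).1, fun hHR ↦ ?_⟩⟩
  exact (h.2 𝒟 h𝒟).2 (hHR.elim Or.inl fun hR ↦ Or.inr (Or.inl hR))

/-- **The pair (residual, crux) implies W**: `GenericCensoredHolesOrRoughSettle → HorizonlessMustDrain → W`, the crux being
used on CK data in the horizonless branch only (as in `closes`). So W is sandwiched: `#5 ∧ HMD ⇒ W ⇒ #5`. [folklore] -/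
theorem undrainedSettle_of_holesOrRough_of_horizonlessMustDrain (hG : GenericCensoredHolesOrRoughSettle)
    (hM : HorizonlessMustDrain) : GenericCensoredHolesOrRoughOrUndrainedSettle := by
  intro X _ _ _ _ _ _
  refine (hG X).mono fun D hD h ↦ ⟨h.1, fun 𝒟 h𝒟 ↦ ⟨(h.2 𝒟 h𝒟).1, fun hA ↦ ?_⟩⟩
  rcases hA with hH | hR | hU
  · exact (h.2 𝒟 h𝒟).2 (Or.inl hH)
  · exact (h.2 𝒟 h𝒟).2 (Or.inr hR)
  · by_cases hH : (∀ [𝒟.metric.HasLeviCivita], ∃ q : 𝒟.carrier, ∀ (p : X) (γ : ℝ → 𝒟.carrier) (dom : Set ℝ),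
        𝒟.metric.IsNormalisedNullRayFrom 𝒟.timeOrientation 𝒟.embed 𝒟.normal p γ dom →
        ¬ BddAbove dom → q ∉ 𝒟.metric.chronologicalPast 𝒟.timeOrientation (γ '' (dom ∩ Set.Ici 0)))
    · exact (h.2 𝒟 h𝒟).2 (Or.inl hH)
    · exact (hU (hM X D hD 𝒟 h𝒟 (h.2 𝒟 h𝒟).1 hH)).elim

/-- **THE ROUTE DECIDES THE STATEMENT WITHOUT `HorizonlessMustDrain`**:
`DrainImpliesDisperseCKH → W → FinalStateConjecture`.  Same proof shape as the route's `closes` (rev 7), with one more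
`by_cases` on `HasVanishingFinalBondiMass`: horizon / rough / undrained MGHDs are the residual's; a CK, horizonless,
DRAINING censored MGHD gets its honest `N = 0` decomposition from the rank-2 crux, with the sub-extremality clause vacuous
over `Fin 0`.  Axioms: propext, Classical.choice, Quot.sound. [folklore] -/
theorem closes_without_horizonlessMustDrain (hΔ : DrainImpliesDisperseCKH)
    (hW : GenericCensoredHolesOrRoughOrUndrainedSettle) : _root_.FinalStateConjecture := by
  intro X _ _ _ _ _ _
  refine (hW X).mono fun D hD h ↦ ⟨h.1, fun 𝒟 h𝒟 ↦ ⟨(h.2 𝒟 h𝒟).1, ?_⟩⟩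
  by_cases hH : (∀ [𝒟.metric.HasLeviCivita], ∃ q : 𝒟.carrier, ∀ (p : X) (γ : ℝ → 𝒟.carrier) (dom : Set ℝ),
      𝒟.metric.IsNormalisedNullRayFrom 𝒟.timeOrientation 𝒟.embed 𝒟.normal p γ dom →
      ¬ BddAbove dom → q ∉ 𝒟.metric.chronologicalPast 𝒟.timeOrientation (γ '' (dom ∩ Set.Ici 0)))
  · exact (h.2 𝒟 h𝒟).2 (Or.inl hH)
  · by_cases hCK : ∃ (e : Literature.Geometry.Lorentzian.AFEnd X) (M : ℝ),
        e.IsSoleEnd ∧ e.IsStronglyAsymptoticallyFlatCK D M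
    · by_cases hU : 𝒟.toCauchyDevelopment.HasVanishingFinalBondiMass
      · obtain ⟨O, d, hN, hO, hR, hE, hF⟩ := hΔ X D hD hCK 𝒟 h𝒟 (h.2 𝒟 h𝒟).1 hH hU
        exact ⟨O, d, fun i ↦ (Fin.cast hN i).elim0, hO, hR, hE, hF⟩
      · exact (h.2 𝒟 h𝒟).2 (Or.inr (Or.inr hU))
    · exact (h.2 𝒟 h𝒟).2 (Or.inr (Or.inl hCK))

/-- **What the Statement needs from the crux is S-provable**: the only consequence of `HorizonlessMustDrain` that
`closes` consumes — the upgrade `GenericCensoredHolesOrRoughSettle → W` of the residual — follows from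
`FinalStateConjecture` itself. [folklore] -/
theorem cruxContribution_of_finalStateConjecture (hS : _root_.FinalStateConjecture) :
    GenericCensoredHolesOrRoughSettle → GenericCensoredHolesOrRoughOrUndrainedSettle :=
  fun _ ↦ undrainedSettle_of_finalStateConjecture hS

/-- **Equivalence of the two cones over the rank-2 crux**: given `DrainImpliesDisperseCKH`, the re-cut residual W is
EQUIVALENT to the Statement (W ⇒ S by `closes_without_horizonlessMustDrain`, S ⇒ W always), whereas the original pair
(`GenericCensoredHolesOrRoughSettle`, `HorizonlessMustDrain`) is strictly on the strong side (it implies W). [folklore] -/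
theorem undrainedSettle_iff_finalStateConjecture (hΔ : DrainImpliesDisperseCKH) :
    GenericCensoredHolesOrRoughOrUndrainedSettle ↔ _root_.FinalStateConjecture :=
  ⟨closes_without_horizonlessMustDrain hΔ, undrainedSettle_of_finalStateConjecture⟩

end Summit.FinalStateConjecture.FinalStateConjecture.Cruxes.HorizonlessMustDrain.CensusS6

end
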